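import Literature.Analysis.SegalBargmann.SchwartzTensorStrongContinuity
import Literature.Analysis.SegalBargmann.SchwartzTensorSchurTransport
import HarnessLib

/-!
# Stripping an operator of `𝓢(ℝ^{σ₁ ⊕ σ₂})` that commutes with the Heisenberg operators of the second block (Folland 1989, §1.4/§1.7)

Topic `Analysis/SegalBargmann`; namespace `Literature.Analysis.SegalBargmann`.  On the Folland carriers
`SR σ = 𝓢(σ → ℝ, ℂ)` with the Heisenberg operators `rhoS p q` [Folland1989, (1.25)] and the product in separate
variables `tensorPi f g = f ⊠ g` (§1.7), this file proves the «SUM-STRIPPING» form of Schur's lemma: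

* **`exists_strip_of_commute_rhoS_inr`**: a CONTINUOUS linear operator `T` of `𝓢(ℝ^{σ₁ ⊕ σ₂})` commuting with
  every Heisenberg operator of the second group of variables, `T ρ(0 ⊔ p₂, 0 ⊔ q₂) = ρ(0 ⊔ p₂, 0 ⊔ q₂) T`, acts on
  separate-variable products through the first factor alone: there is a continuous linear `T₁` of `𝓢(ℝ^{σ₁})` with
  `T (f ⊠ g) = T₁ f ⊠ g` for all `f, g`; `T₁` is unique (`strip_unique`, by `⊠ g`-cancellation `tensorPi_left_cancel`).
  Proof: the `σ₂`-slice `g ↦ (T (f ⊠ g))(x₁ ⊔ ·)` (`sliceInr x₁`, Mathlib's `SchwartzMap.compCLMOfAntilipschitz` along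
  the isometric affine embedding `x₂ ↦ x₁ ⊔ x₂`) is a continuous operator of `𝓢(ℝ^{σ₂})` commuting with all
  `ρ(p₂, q₂)`, hence a scalar `c(f, x₁)` by Schur's lemma on Schwartz space (`eq_smul_of_commute_rhoS`, tree
  `SchwartzHeisenbergSchur`); reading `c(f, ·)` off one slice `x₂ = x₂⁰` with `g₀(x₂⁰) ≠ 0` gives `T₁`.
* **`exists_strip_tensorD_of_commute_rhoSD_inr`**, **`exists_strip_piBoxTensor_of_commute_rhoSD_inr`**: the same on
  transported carriers `𝓢(D)` (`rhoSD`, `tensorD`) and on function carriers `𝓢((ι₁ ⊕ ι₂) → V)` (`piBoxTensor`,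
  basis coordinates `sumCarrierEquiv b` / `piCarrierEquiv b`), in the format of `SchwartzTensorSchurProjective`.

This is the direction of [MoeglinVignerasWaldspurger1987, Chap. 2 II.1 Rem. (6)] / Weil's functoriality for an
orthogonal direct sum that PRODUCES the operator on the first summand from an operator on the sum commuting with the
second Heisenberg group (the archimedean half of the adelic statement `Weil1964/AdelicMetaplecticSumStripping`).
Everything is PROVED from Mathlib and the imported tree files; no cited statement is used as a hypothesis.

## References

* [Folland1989] G. B. Folland, *Harmonic Analysis in Phase Space*, Princeton UP (1989), §1.3 (1.25), §1.4 Prop. (1.43),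
  §1.7.
* [MoeglinVignerasWaldspurger1987] C. Mœglin, M.-F. Vignéras, J.-L. Waldspurger, *Correspondances de Howe sur un corps
  p-adique*, LNM 1291 (1987), Chap. 2 II.1 Rem. (6).

## Provenance

LEAN-IN-TREE rule (2026-08-18), pub-hodgecm model-construction sub-cell, seat own-crow gen 2 (third hand on the
[GelbartRogawski1991, Prop. 3.1.1] construction, stub S4 «undoubling» of GR-2's `GRSkeleton`).
-/

set_option autoImplicit false

noncomputable section

open MeasureTheory Complex SchwartzMap Filter Topology
open scoped BigOperators Real
open Literature.Analysis.Distribution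

namespace Literature.Analysis.SegalBargmann

local notation "SR" σ:max => (SchwartzMap (σ → ℝ) ℂ)
local notation "SD" D:max => (SchwartzMap D ℂ)

/-! ## §1  Slices of Schwartz functions on `ℝ^{σ₁ ⊕ σ₂}` -/

section Slices

variable {σ₁ σ₂ : Type*} [Fintype σ₁] [Fintype σ₂]

omit [Fintype σ₁] [Fintype σ₂] in
/-- `(x₁ ⊔ x₂) + (y₁ ⊔ y₂) = (x₁ + y₁) ⊔ (x₂ + y₂)`. [folklore] -/
private theorem sumElim_add_sumElim (x₁ y₁ : σ₁ → ℝ) (x₂ y₂ : σ₂ → ℝ) :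
    Sum.elim x₁ x₂ + Sum.elim y₁ y₂ = Sum.elim (x₁ + y₁) (x₂ + y₂) := by
  funext i; cases i <;> rfl

/-- The affine embedding `x₂ ↦ x₁ ⊔ x₂` of the second block has temperate growth. [folklore] -/
private theorem hasTemperateGrowth_sumElim_right (x₁ : σ₁ → ℝ) :
    Function.HasTemperateGrowth fun x₂ : σ₂ → ℝ => Sum.elim x₁ x₂ := by
  let L : (σ₂ → ℝ) →L[ℝ] (σ₁ ⊕ σ₂ → ℝ) :=
    ContinuousLinearMap.pi fun i => match i with
      | Sum.inl _ => 0
      | Sum.inr j => ContinuousLinearMap.proj j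
  have h : (fun x₂ : σ₂ → ℝ => Sum.elim x₁ x₂) = fun x₂ => Sum.elim x₁ (0 : σ₂ → ℝ) + L x₂ := by
    funext x₂
    funext i
    rcases i with i | j
    · simp [L]
    · simp [L]
  rw [h]
  exact (Function.HasTemperateGrowth.const _).add L.hasTemperateGrowth

/-- The affine embedding `x₁ ↦ x₁ ⊔ x₂` of the first block has temperate growth. [folklore] -/
private theorem hasTemperateGrowth_sumElim_left (x₂ : σ₂ → ℝ) :
    Function.HasTemperateGrowth fun x₁ : σ₁ → ℝ => Sum.elim x₁ x₂ := by
  let L : (σ₁ → ℝ) →L[ℝ] (σ₁ ⊕ σ₂ → ℝ) :=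
    ContinuousLinearMap.pi fun i => match i with
      | Sum.inl j => ContinuousLinearMap.proj j
      | Sum.inr _ => 0
  have h : (fun x₁ : σ₁ → ℝ => Sum.elim x₁ x₂) = fun x₁ => Sum.elim (0 : σ₁ → ℝ) x₂ + L x₁ := by
    funext x₁
    funext i
    rcases i with i | j
    · simp [L]
    · simp [L]
  rw [h]
  exact (Function.HasTemperateGrowth.const _).add L.hasTemperateGrowth

/-- `x₂ ↦ x₁ ⊔ x₂` is `1`-antilipschitz (an isometric embedding for the sup norms). [folklore] -/
private theorem antilipschitz_sumElim_right (x₁ : σ₁ → ℝ) :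
    AntilipschitzWith 1 fun x₂ : σ₂ → ℝ => Sum.elim x₁ x₂ := by
  refine AntilipschitzWith.of_le_mul_dist fun x₂ y₂ => ?_
  rw [NNReal.coe_one, one_mul, dist_pi_le_iff dist_nonneg]
  intro j
  exact dist_le_pi_dist (Sum.elim x₁ x₂) (Sum.elim x₁ y₂) (Sum.inr j)

/-- `x₁ ↦ x₁ ⊔ x₂` is `1`-antilipschitz. [folklore] -/
private theorem antilipschitz_sumElim_left (x₂ : σ₂ → ℝ) :
    AntilipschitzWith 1 fun x₁ : σ₁ → ℝ => Sum.elim x₁ x₂ := by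
  refine AntilipschitzWith.of_le_mul_dist fun x₁ y₁ => ?_
  rw [NNReal.coe_one, one_mul, dist_pi_le_iff dist_nonneg]
  intro i
  exact dist_le_pi_dist (Sum.elim x₁ x₂) (Sum.elim y₁ x₂) (Sum.inl i)

/-- **The `σ₂`-slice at `x₁`**: `𝓢(ℝ^{σ₁ ⊕ σ₂}) →L[ℂ] 𝓢(ℝ^{σ₂})`, `Ψ ↦ (x₂ ↦ Ψ(x₁ ⊔ x₂))`. [folklore] -/
def sliceInr (x₁ : σ₁ → ℝ) : (SR (σ₁ ⊕ σ₂)) →L[ℂ] SR σ₂ :=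
  SchwartzMap.compCLMOfAntilipschitz ℂ (hasTemperateGrowth_sumElim_right x₁) (antilipschitz_sumElim_right x₁)

/-- Pointwise: `sliceInr x₁ Ψ x₂ = Ψ (x₁ ⊔ x₂)`. [folklore] -/
@[simp] private theorem sliceInr_apply (x₁ : σ₁ → ℝ) (Ψ : SR (σ₁ ⊕ σ₂)) (x₂ : σ₂ → ℝ) :
    sliceInr x₁ Ψ x₂ = Ψ (Sum.elim x₁ x₂) := rfl

/-- **The `σ₁`-slice at `x₂`**: `𝓢(ℝ^{σ₁ ⊕ σ₂}) →L[ℂ] 𝓢(ℝ^{σ₁})`, `Ψ ↦ (x₁ ↦ Ψ(x₁ ⊔ x₂))`. [folklore] -/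
def sliceInl (x₂ : σ₂ → ℝ) : (SR (σ₁ ⊕ σ₂)) →L[ℂ] SR σ₁ :=
  SchwartzMap.compCLMOfAntilipschitz ℂ (hasTemperateGrowth_sumElim_left x₂) (antilipschitz_sumElim_left x₂)

/-- Pointwise: `sliceInl x₂ Ψ x₁ = Ψ (x₁ ⊔ x₂)`. [folklore] -/
@[simp] private theorem sliceInl_apply (x₂ : σ₂ → ℝ) (Ψ : SR (σ₁ ⊕ σ₂)) (x₁ : σ₁ → ℝ) :
    sliceInl x₂ Ψ x₁ = Ψ (Sum.elim x₁ x₂) := rfl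

/-- `ρ(0, 0) = 1` on `𝓢(ℝ^σ)`. [folklore] -/
private theorem rhoS_zero_zero {σ : Type*} [Fintype σ] (f : SR σ) : rhoS (0 : σ → ℝ) 0 f = f := by
  ext x
  rw [rhoS_apply, add_zero, rhoMul]
  simp

/-- **Slicing intertwines the second-block Heisenberg operators with those of `𝓢(ℝ^{σ₂})`**:
`(ρ(0 ⊔ p₂, 0 ⊔ q₂) Ψ)(x₁ ⊔ ·) = ρ(p₂, q₂) (Ψ(x₁ ⊔ ·))`. [cite: Folland1989, (1.25)] -/
theorem sliceInr_rhoS_inr (x₁ : σ₁ → ℝ) (p₂ q₂ : σ₂ → ℝ) (Ψ : SR (σ₁ ⊕ σ₂)) :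
    sliceInr x₁ (rhoS (Sum.elim (0 : σ₁ → ℝ) p₂) (Sum.elim (0 : σ₁ → ℝ) q₂) Ψ) = rhoS p₂ q₂ (sliceInr x₁ Ψ) := by
  ext x₂
  rw [sliceInr_apply, rhoS_apply, rhoS_apply, sliceInr_apply, rhoMul_sum_elim, Sum.elim_comp_inl, Sum.elim_comp_inr,
    sumElim_add_sumElim, add_zero]
  have h0 : rhoMul (0 : σ₁ → ℝ) 0 x₁ = 1 := by rw [rhoMul]; simp
  rw [h0, one_mul]

/-- **`f ⊠ ρ(p₂, q₂) g = ρ(0 ⊔ p₂, 0 ⊔ q₂) (f ⊠ g)`.** [cite: Folland1989, (1.25)] -/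
theorem tensorPi_rhoS_right (p₂ q₂ : σ₂ → ℝ) (f : SR σ₁) (g : SR σ₂) :
    tensorPi f (rhoS p₂ q₂ g) = rhoS (Sum.elim (0 : σ₁ → ℝ) p₂) (Sum.elim (0 : σ₁ → ℝ) q₂) (tensorPi f g) := by
  rw [rhoS_tensorPi, rhoS_zero_zero]

/-- **`⊠ g`-cancellation**: `f ⊠ g = f' ⊠ g` with `g ≠ 0` forces `f = f'` (products in separate variables,
[Folland1989, §1.7]). [cite: Folland1989, §1.7] -/
theorem tensorPi_left_cancel {f f' : SR σ₁} {g : SR σ₂} (hg : g ≠ 0) (h : tensorPi f g = tensorPi f' g) :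
    f = f' := by
  obtain ⟨x₂, hx₂⟩ : ∃ x₂, g x₂ ≠ 0 := DFunLike.ne_iff.1 hg
  ext x₁
  have h1 := congrArg (fun Ψ : SR (σ₁ ⊕ σ₂) => Ψ (Sum.elim x₁ x₂)) h
  simp only [tensorPi_apply, Sum.elim_comp_inl, Sum.elim_comp_inr] at h1
  exact mul_right_cancel₀ hx₂ h1

/-- `f ⊠ ·`-cancellation: `f ⊠ g = f ⊠ g'` with `f ≠ 0` forces `g = g'`. [cite: Folland1989, §1.7] -/
theorem tensorPi_right_cancel {f : SR σ₁} {g g' : SR σ₂} (hf : f ≠ 0) (h : tensorPi f g = tensorPi f g') :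
    g = g' := by
  obtain ⟨x₁, hx₁⟩ : ∃ x₁, f x₁ ≠ 0 := DFunLike.ne_iff.1 hf
  ext x₂
  have h1 := congrArg (fun Ψ : SR (σ₁ ⊕ σ₂) => Ψ (Sum.elim x₁ x₂)) h
  simp only [tensorPi_apply, Sum.elim_comp_inl, Sum.elim_comp_inr] at h1
  exact mul_left_cancel₀ hx₁ h1

end Slices

/-! ## §2  The stripping theorem on `𝓢(ℝ^{σ₁ ⊕ σ₂})` -/

section Strip

variable {σ₁ σ₂ : Type*} [Fintype σ₁] [Fintype σ₂]

/-- `g ↦ f ⊠ g` as a continuous linear map (the tree's `sumProdRightCLM`). [folklore] -/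
private theorem sumProdRightCLM_apply_eq_tensorPi (f : SR σ₁) (g : SR σ₂) :
    SchwartzMap.sumProdRightCLM f g = tensorPi f g := by
  ext x; rfl

/-- The **slice coefficient operator** of `T` at `(f, x₁)`: `g ↦ (T (f ⊠ g))(x₁ ⊔ ·)`, a continuous linear
operator of `𝓢(ℝ^{σ₂})`. [folklore] -/
def sliceCoeffOp (T : (SR (σ₁ ⊕ σ₂)) →L[ℂ] SR (σ₁ ⊕ σ₂)) (f : SR σ₁) (x₁ : σ₁ → ℝ) : (SR σ₂) →L[ℂ] SR σ₂ :=
  (sliceInr x₁).comp (T.comp (SchwartzMap.sumProdRightCLM f))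

/-- Unfolding. [folklore] -/
private theorem sliceCoeffOp_apply (T : (SR (σ₁ ⊕ σ₂)) →L[ℂ] SR (σ₁ ⊕ σ₂)) (f : SR σ₁) (x₁ : σ₁ → ℝ) (g : SR σ₂) :
    sliceCoeffOp T f x₁ g = sliceInr x₁ (T (tensorPi f g)) := by
  rw [sliceCoeffOp, ContinuousLinearMap.comp_apply, ContinuousLinearMap.comp_apply, sumProdRightCLM_apply_eq_tensorPi]

/-- If `T` commutes with the second-block Heisenberg operators, every slice coefficient operator commutes with ALL
Heisenberg operators of `𝓢(ℝ^{σ₂})`. [cite: Folland1989, (1.25)] -/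
theorem sliceCoeffOp_comm_rhoS (T : (SR (σ₁ ⊕ σ₂)) →L[ℂ] SR (σ₁ ⊕ σ₂))
    (hT : ∀ (p₂ q₂ : σ₂ → ℝ) (Ψ : SR (σ₁ ⊕ σ₂)),
      T (rhoS (Sum.elim (0 : σ₁ → ℝ) p₂) (Sum.elim (0 : σ₁ → ℝ) q₂) Ψ) =
        rhoS (Sum.elim (0 : σ₁ → ℝ) p₂) (Sum.elim (0 : σ₁ → ℝ) q₂) (T Ψ))
    (f : SR σ₁) (x₁ : σ₁ → ℝ) (p₂ q₂ : σ₂ → ℝ) (g : SR σ₂) :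
    sliceCoeffOp T f x₁ (rhoS p₂ q₂ g) = rhoS p₂ q₂ (sliceCoeffOp T f x₁ g) := by
  rw [sliceCoeffOp_apply, sliceCoeffOp_apply, tensorPi_rhoS_right, hT, sliceInr_rhoS_inr]

/-- The **slice coefficient** `c(f, x₁)`: the Schur scalar of the slice coefficient operator. [folklore] -/
def sliceCoeff [DecidableEq σ₂] (T : (SR (σ₁ ⊕ σ₂)) →L[ℂ] SR (σ₁ ⊕ σ₂)) (f : SR σ₁) (x₁ : σ₁ → ℝ) : ℂ :=
  schurCoeff (sliceCoeffOp T f x₁)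

/-- **Schur on every slice**: `(T (f ⊠ g))(x₁ ⊔ x₂) = c(f, x₁) · g(x₂)`. [cite: Folland1989, Prop. (1.43)] -/
theorem apply_tensorPi_sumElim [DecidableEq σ₂] (T : (SR (σ₁ ⊕ σ₂)) →L[ℂ] SR (σ₁ ⊕ σ₂))
    (hT : ∀ (p₂ q₂ : σ₂ → ℝ) (Ψ : SR (σ₁ ⊕ σ₂)),
      T (rhoS (Sum.elim (0 : σ₁ → ℝ) p₂) (Sum.elim (0 : σ₁ → ℝ) q₂) Ψ) =
        rhoS (Sum.elim (0 : σ₁ → ℝ) p₂) (Sum.elim (0 : σ₁ → ℝ) q₂) (T Ψ))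
    (f : SR σ₁) (g : SR σ₂) (x₁ : σ₁ → ℝ) (x₂ : σ₂ → ℝ) :
    T (tensorPi f g) (Sum.elim x₁ x₂) = sliceCoeff T f x₁ * g x₂ := by
  have h := eq_smul_of_commute_rhoS (sliceCoeffOp T f x₁) (sliceCoeffOp_comm_rhoS T hT f x₁) g
  rw [sliceCoeffOp_apply] at h
  have h2 := congrArg (fun φ : SR σ₂ => φ x₂) h
  simp only [sliceInr_apply, _root_.smul_apply, smul_eq_mul] at h2
  exact h2

/-- **THE STRIPPING THEOREM on `𝓢(ℝ^{σ₁ ⊕ σ₂})`.** A continuous linear operator `T` commuting with every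
Heisenberg operator `ρ(0 ⊔ p₂, 0 ⊔ q₂)` of the second group of variables acts on separate-variable products through
the first factor: `T (f ⊠ g) = T₁ f ⊠ g` for a continuous linear `T₁` of `𝓢(ℝ^{σ₁})` and all `f, g`.
[cite: Folland1989, Prop. (1.43); MoeglinVignerasWaldspurger1987, Chap. 2 II.1 Rem. (6)] -/
theorem exists_strip_of_commute_rhoS_inr [DecidableEq σ₂] (T : (SR (σ₁ ⊕ σ₂)) →L[ℂ] SR (σ₁ ⊕ σ₂))
    (hT : ∀ (p₂ q₂ : σ₂ → ℝ) (Ψ : SR (σ₁ ⊕ σ₂)),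
      T (rhoS (Sum.elim (0 : σ₁ → ℝ) p₂) (Sum.elim (0 : σ₁ → ℝ) q₂) Ψ) =
        rhoS (Sum.elim (0 : σ₁ → ℝ) p₂) (Sum.elim (0 : σ₁ → ℝ) q₂) (T Ψ)) :
    ∃ T₁ : (SR σ₁) →L[ℂ] SR σ₁, ∀ (f : SR σ₁) (g : SR σ₂), T (tensorPi f g) = tensorPi (T₁ f) g := by
  -- a test function of the second block and a point where it does not vanish
  obtain ⟨x₂, hx₂⟩ : ∃ x₂ : σ₂ → ℝ, (hermitePi (0 : σ₂ →₀ ℕ) : SR σ₂) x₂ ≠ 0 :=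
    DFunLike.ne_iff.1 (hermitePi_ne_zero (0 : σ₂ →₀ ℕ))
  set g₀ : SR σ₂ := hermitePi (0 : σ₂ →₀ ℕ) with hg₀
  -- `T₁ f := g₀(x₂)⁻¹ • (T (f ⊠ g₀))(· ⊔ x₂)`, so that `T₁ f x₁ = c(f, x₁)`
  refine ⟨(g₀ x₂)⁻¹ • ((sliceInl x₂).comp (T.comp (SchwartzMap.sumProdLeftCLM g₀))), fun f g => ?_⟩
  have hT₁ : ∀ x₁ : σ₁ → ℝ,
      ((g₀ x₂)⁻¹ • ((sliceInl x₂).comp (T.comp (SchwartzMap.sumProdLeftCLM g₀)))) f x₁ = sliceCoeff T f x₁ := by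
    intro x₁
    rw [_root_.smul_apply, _root_.smul_apply, ContinuousLinearMap.comp_apply,
      ContinuousLinearMap.comp_apply, sumProdLeftCLM_eq_tensorPi, sliceInl_apply, apply_tensorPi_sumElim T hT,
      smul_eq_mul, ← mul_assoc, mul_comm ((g₀ x₂)⁻¹), mul_assoc, inv_mul_cancel₀ hx₂, mul_one]
  ext x
  rw [← Sum.elim_comp_inl_inr x, apply_tensorPi_sumElim T hT, tensorPi_apply, Sum.elim_comp_inl, Sum.elim_comp_inr,
    hT₁]

/-- **Uniqueness of the stripped operator**: `T₁` is determined by `T (f ⊠ g) = T₁ f ⊠ g` (any one `g ≠ 0`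
suffices). [cite: Folland1989, §1.7] -/
theorem strip_unique {T₁ T₁' : (SR σ₁) →L[ℂ] SR σ₁} {g : SR σ₂} (hg : g ≠ 0)
    (h : ∀ f : SR σ₁, tensorPi (T₁ f) g = tensorPi (T₁' f) g) : T₁ = T₁' :=
  ContinuousLinearMap.ext fun f => tensorPi_left_cancel hg (h f)

end Strip

/-! ## §3  Transported and function-carrier forms -/

section Transport

variable {σ₁ σ₂ : Type*} [Fintype σ₁] [Fintype σ₂]
variable {D₁ D₂ D : Type*} [NormedAddCommGroup D₁] [NormedSpace ℝ D₁] [NormedAddCommGroup D₂] [NormedSpace ℝ D₂]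
  [NormedAddCommGroup D] [NormedSpace ℝ D]
variable (e₁ : D₁ ≃L[ℝ] (σ₁ → ℝ)) (e₂ : D₂ ≃L[ℝ] (σ₂ → ℝ)) (e : D ≃L[ℝ] (σ₁ ⊕ σ₂ → ℝ))

/-- **The stripping theorem on transported carriers** `𝓢(D)`, `𝓢(D₁)` (`ρ_D = rhoSD e`, `⊠ = tensorD e₁ e₂ e`): a
continuous `A` commuting with `ρ_D(0 ⊔ p₂, 0 ⊔ q₂)` for all `p₂, q₂` satisfies `A (f ⊠ g) = A₁ f ⊠ g` for a
continuous linear `A₁` of `𝓢(D₁)`. [cite: Folland1989, Prop. (1.43)] -/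
theorem exists_strip_tensorD_of_commute_rhoSD_inr [DecidableEq σ₂] (A : (SD D) →L[ℂ] SD D)
    (hA : ∀ (p₂ q₂ : σ₂ → ℝ) (F : SD D),
      A (rhoSD e (Sum.elim (0 : σ₁ → ℝ) p₂) (Sum.elim (0 : σ₁ → ℝ) q₂) F) =
        rhoSD e (Sum.elim (0 : σ₁ → ℝ) p₂) (Sum.elim (0 : σ₁ → ℝ) q₂) (A F)) :
    ∃ A₁ : (SD D₁) →L[ℂ] SD D₁, ∀ (f : SD D₁) (g : SD D₂), A (tensorD e₁ e₂ e f g) = tensorD e₁ e₂ e (A₁ f) g := by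
  have hA' : ∀ (p₂ q₂ : σ₂ → ℝ) (G : SR (σ₁ ⊕ σ₂)),
      conjS e A (rhoS (Sum.elim (0 : σ₁ → ℝ) p₂) (Sum.elim (0 : σ₁ → ℝ) q₂) G) =
        rhoS (Sum.elim (0 : σ₁ → ℝ) p₂) (Sum.elim (0 : σ₁ → ℝ) q₂) (conjS e A G) := fun p₂ q₂ G => by
    rw [conjS_apply, conjS_apply, schwartzTransport_symm_rhoS, hA, schwartzTransport_rhoSD]
  obtain ⟨T₁, hT₁⟩ := exists_strip_of_commute_rhoS_inr (conjS e A) hA'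
  refine ⟨((schwartzTransport e₁).symm : (SR σ₁) →L[ℂ] SD D₁).comp (T₁.comp (schwartzTransport e₁ : (SD D₁) →L[ℂ] SR σ₁)),
    fun f g => ?_⟩
  have h1 := hT₁ (schwartzTransport e₁ f) (schwartzTransport e₂ g)
  rw [conjS_apply, ← schwartzTransport_tensorD e₁ e₂ e, ContinuousLinearEquiv.symm_apply_apply] at h1
  have h2 := congrArg (schwartzTransport e).symm h1
  rw [ContinuousLinearEquiv.symm_apply_apply] at h2
  rw [h2, tensorD, ContinuousLinearMap.comp_apply, ContinuousLinearMap.comp_apply, ContinuousLinearEquiv.coe_coe,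
    ContinuousLinearEquiv.coe_coe, ContinuousLinearEquiv.apply_symm_apply]

/-- `⊠ g`-cancellation on transported carriers. [cite: Folland1989, §1.7] -/
theorem tensorD_left_cancel {f f' : SD D₁} {g : SD D₂} (hg : g ≠ 0)
    (h : tensorD e₁ e₂ e f g = tensorD e₁ e₂ e f' g) : f = f' := by
  have hg' : schwartzTransport e₂ g ≠ 0 := fun h0 => hg ((schwartzTransport e₂).map_eq_zero_iff.1 h0)
  have h1 := congrArg (schwartzTransport e) h
  rw [schwartzTransport_tensorD, schwartzTransport_tensorD] at h1
  exact (schwartzTransport e₁).injective (tensorPi_left_cancel hg' h1)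

end Transport

section FunctionCarrier

variable {V : Type*} [NormedAddCommGroup V] [NormedSpace ℝ V] {τ : Type*} [Fintype τ] (b : Module.Basis τ ℝ V)
variable {ι₁ ι₂ : Type*} [Fintype ι₁] [Fintype ι₂]

/-- **The stripping theorem on function carriers `𝓢((ι₁ ⊕ ι₂) → V)`** (Heisenberg operators
`rhoSD (sumCarrierEquiv b ι₁ ι₂)`, `⊠ = piBoxTensor`): a continuous `A` commuting with the second-block operators
`ρ(0 ⊔ p₂, 0 ⊔ q₂)` satisfies `A (f ⊠ g) = A₁ f ⊠ g` for a continuous linear `A₁` of `𝓢(ι₁ → V)` and all `f, g`.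
[cite: Folland1989, Prop. (1.43)] -/
theorem exists_strip_piBoxTensor_of_commute_rhoSD_inr (A : (SD (ι₁ ⊕ ι₂ → V)) →L[ℂ] SD (ι₁ ⊕ ι₂ → V))
    (hA : ∀ (p₂ q₂ : ι₂ × τ → ℝ) (F : SD (ι₁ ⊕ ι₂ → V)),
      A (rhoSD (sumCarrierEquiv b ι₁ ι₂) (Sum.elim (0 : ι₁ × τ → ℝ) p₂) (Sum.elim (0 : ι₁ × τ → ℝ) q₂) F) =
        rhoSD (sumCarrierEquiv b ι₁ ι₂) (Sum.elim (0 : ι₁ × τ → ℝ) p₂) (Sum.elim (0 : ι₁ × τ → ℝ) q₂) (A F)) :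
    ∃ A₁ : (SD (ι₁ → V)) →L[ℂ] SD (ι₁ → V), ∀ (f : SD (ι₁ → V)) (g : SD (ι₂ → V)),
      A (piBoxTensor f g) = piBoxTensor (A₁ f) g := by
  classical
  obtain ⟨A₁, h⟩ := exists_strip_tensorD_of_commute_rhoSD_inr (piCarrierEquiv b ι₁) (piCarrierEquiv b ι₂)
    (sumCarrierEquiv b ι₁ ι₂) A hA
  refine ⟨A₁, fun f g => ?_⟩
  rw [piBoxTensor_eq_tensorD b, piBoxTensor_eq_tensorD b, h]

omit [Fintype τ] in
/-- `⊠ g`-cancellation on function carriers. [cite: Folland1989, §1.7] -/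
theorem piBoxTensor_left_cancel {f f' : SD (ι₁ → V)} {g : SD (ι₂ → V)} (hg : g ≠ 0)
    (h : piBoxTensor f g = piBoxTensor f' g) : f = f' := by
  obtain ⟨x₂, hx₂⟩ : ∃ x₂, g x₂ ≠ 0 := DFunLike.ne_iff.1 hg
  ext x₁
  have h1 := congrArg (fun Ψ : SD (ι₁ ⊕ ι₂ → V) => Ψ (Sum.elim x₁ x₂)) h
  simp only [piBoxTensor_apply, Sum.elim_comp_inl, Sum.elim_comp_inr] at h1
  exact mul_right_cancel₀ hx₂ h1

end FunctionCarrier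

end Literature.Analysis.SegalBargmann

end
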